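import Summits.Ventures.HSemireg.WedgeHankelRecurrenceRouthScheme
import Summits.Ventures.HSemireg.WedgeHankelRecurrenceHermiteBiehler

/-!
# Venture HSemireg — A NECESSARY CONDITION READ OFF ROUTH'S STEP: for a real Hurwitz polynomial `p = Σ a_k X^k` of degree `≥ 3` with `a_n > 0`, **`a_0·a_{2k+3} < a_1·a_{2k+2}`** for every
# admissible `k` (at `k = 0`: the classical `a_0 a_3 < a_1 a_2`), because the Routh transform `p̃` is again Hurwitz (N202) and therefore has positive coefficients (N198)

HONEST FRAMING. Part of the Lean index of the computation cell `pub-hsemireg` (seat p10 gen 38, Sunday typer «UNIFORM-IN-n»).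
REAL POLYNOMIALS ONLY: no variety, no cohomology theory, no sheaf, no Ext group and no semiregularity map is constructed here; nothing here says that HC / HC_CM / HC_AV holds; no Literature
fact (unproved `Prop`) is declared or used.  Custodian versions as in `WedgeHankelSiegelIdeal` (1/3).
SOURCE (cited; held text read): O. Holtz, LAA 372 (2003) Thm 2 (`paper:arxiv-math_0512591` p0004; typed as N202 `forall_re_neg_iff_routh_of_even/odd`): the Routh transform
`p̃ = g(X²) + X g₁(X²)`, `g₁ = (f − c g)/X`, `c = f(0)/g(0)`, of a Hurwitz `p = f(X²) + X g(X²)` is Hurwitz; V. V. Prasolov, Polynomials Thm 1.1.14 (proof; typed as N198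
`coeff_pos_of_forall_re_neg`): a Hurwitz polynomial with positive leading coefficient has positive coefficients.  THIS FILE (elementary corollary, no further printed locus claimed): the odd
coefficients of `p̃` are `(g₁)_k = f_{k+1} − c·g_{k+1}`, so their positivity reads `f_0 g_{k+1} < f_{k+1} g_0`, i.e. `a_0 a_{2k+3} < a_{2k+2} a_1`; the case `k = 0` is the degree-3 Routh–Hurwitz
inequality `a_0 a_3 < a_1 a_2` (cf. N196's Maxwell condition `c < ab` for `X³ + aX² + bX + c`), valid in every degree `≥ 3`.
DEDUP DISCLOSURE (`rg` of the whole tree + Mathlib, 2026-09-02): N196 has the cubic criterion; N198 the positivity of the coefficients; the mixed products `a_0 a_{2k+3} < a_1 a_{2k+2}` in all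
degrees are new.  5 names: 0 hits tree-wide + Mathlib.

WHAT IS IN THE TREE.  N202 `forall_re_neg_iff_routh_of_even ∕ _of_odd`, `coeff_zero_ne_zero_of_forall_re_neg`; N203 `leadingCoeff_even_add_odd_of_even ∕ _of_odd`; N201 `coeff_even_eq`,
`coeff_odd_eq`; N198 `coeff_pos_of_forall_re_neg`; Mathlib `coeff_divX`, `coeff_eq_zero_of_natDegree_lt`.
THIS FILE (namespace `Summit.Ventures.HSemireg.Wedge.HankelOuter` continued; CHAINED on N202 + N203; 0 definitions):
* §901 `coeff_divX_routh` (`(g₁)_k = f_{k+1} − c g_{k+1}`), **`coeff_mul_coeff_lt_of_forall_re_neg_of_even`** (`deg p = 2m + 4`: `f_0 g_{k+1} < f_{k+1} g_0` for `k ≤ m + 1`),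
  **`coeff_mul_coeff_lt_of_forall_re_neg_of_odd`** (`deg p = 2m + 3`: the same for `k ≤ m`), and in the coefficients of `p`: `coeff_zero_mul_coeff_lt_of_even ∕ _of_odd`
  (`p_0 p_{2k+3} < p_{2k+2} p_1`).
CAVEATS.  Degree `≥ 3` (the Routh transform must have degree `≥ 2` for N202's indexing); `lc(p) > 0` assumed.  Nothing Ext-side.  New names only.
-/

open Module Polynomial
open scoped Matrix Polynomial

namespace Summit.Ventures.HSemireg.Wedge.HankelOuter

open Summit.Ventures.HSemireg.Wedge Summit.Ventures.HSemireg.Wedge.Hankel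

/-! ## §901. `a_0 a_{2k+3} < a_1 a_{2k+2}` -/

/-- `(g₁)_k = f_{k+1} − c·g_{k+1}` for `g₁ = (f − c g)/X`. [bookkeeping; this file §901] -/
theorem coeff_divX_routh (f g : ℝ[X]) (c : ℝ) (k : ℕ) : (f - C c * g).divX.coeff k = f.coeff (k + 1) - c * g.coeff (k + 1) := by
  rw [coeff_divX, coeff_sub, coeff_C_mul]

/-- **Even degree `2m + 4`: a Hurwitz `p = f(X²) + X g(X²)` with `deg f = m + 2`, `deg g ≤ m + 1`, `lc f > 0` has `f_0·g_{k+1} < f_{k+1}·g_0` for all `k ≤ m + 1`.** [Routh step N202 + N198;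
this file §901] -/
theorem coeff_mul_coeff_lt_of_forall_re_neg_of_even (m : ℕ) {f g : ℝ[X]} (hf : f.natDegree = m + 2) (hg : g.natDegree ≤ m + 1) (hlc : 0 < f.leadingCoeff)
    (h : ∀ z ∈ ((expand ℝ 2 f + Polynomial.X * expand ℝ 2 g).map (algebraMap ℝ ℂ)).roots, z.re < 0) {k : ℕ} (hk : k ≤ m + 1) :
    f.coeff 0 * g.coeff (k + 1) < f.coeff (k + 1) * g.coeff 0 := by
  obtain ⟨hc, hst⟩ := (forall_re_neg_iff_routh_of_even m hf hg).1 h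
  set c := f.coeff 0 / g.coeff 0 with hcdef
  set g₁ := (f - C c * g).divX with hg₁
  have hp : (expand ℝ 2 f + Polynomial.X * expand ℝ 2 g).natDegree = 2 * m + 4 := by
    rw [natDegree_even_add_odd_of_lt_left (by omega), hf]; ring
  have hg00 : g.coeff 0 ≠ 0 := coeff_zero_ne_zero_of_forall_re_neg (by rw [hp]; omega) h
  -- `g(0) > 0`: the coefficient `p_1`
  have hg0 : 0 < g.coeff 0 := by
    have := coeff_pos_of_forall_re_neg (by rwa [leadingCoeff_even_add_odd_of_even (by omega)]) h 1 (by rw [hp]; omega)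
    rwa [show (1 : ℕ) = 2 * 0 + 1 by ring, coeff_odd_eq] at this
  -- the Routh transform has positive coefficients
  have hsub : (f - C c * g).natDegree = m + 2 := by
    rw [natDegree_sub_eq_left_of_natDegree_lt (lt_of_le_of_lt ((natDegree_C_mul_le _ _).trans hg) (by omega)), hf]
  have hg₁d : g₁.natDegree = m + 1 := by rw [hg₁, natDegree_divX_eq_natDegree_tsub_one, hsub]; rfl
  have hg₁0 : g₁ ≠ 0 := by rintro h0; rw [h0, natDegree_zero] at hg₁d; omega
  have hp₁ : (expand ℝ 2 g + Polynomial.X * expand ℝ 2 g₁).natDegree = 2 * m + 3 := by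
    rw [natDegree_even_add_odd_of_le_right hg₁0 (by omega), hg₁d]; ring
  have hlc₁ : 0 < (expand ℝ 2 g + Polynomial.X * expand ℝ 2 g₁).leadingCoeff := by
    rw [leadingCoeff_even_add_odd_of_odd hg₁0 (by omega), leadingCoeff, hg₁d, hg₁, coeff_divX_routh, coeff_eq_zero_of_natDegree_lt (show g.natDegree < m + 1 + 1 by omega), mul_zero,
      sub_zero, show m + 1 + 1 = f.natDegree by rw [hf], ← leadingCoeff]
    exact hlc
  have hpos := coeff_pos_of_forall_re_neg hlc₁ hst (2 * k + 1) (by rw [hp₁]; omega)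
  rw [coeff_odd_eq, hg₁, coeff_divX_routh, hcdef, sub_pos, div_mul_eq_mul_div, div_lt_iff₀ hg0] at hpos
  exact hpos

/-- **Odd degree `2m + 3`: a Hurwitz `p = f(X²) + X g(X²)` with `deg g = m + 1`, `deg f ≤ m + 1`, `lc g > 0` has `f_0·g_{k+1} < f_{k+1}·g_0` for all `k ≤ m`.** [Routh step N202 + N198; this
file §901] -/
theorem coeff_mul_coeff_lt_of_forall_re_neg_of_odd (m : ℕ) {f g : ℝ[X]} (hg : g.natDegree = m + 1) (hf : f.natDegree ≤ m + 1) (hlc : 0 < g.leadingCoeff)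
    (h : ∀ z ∈ ((expand ℝ 2 f + Polynomial.X * expand ℝ 2 g).map (algebraMap ℝ ℂ)).roots, z.re < 0) {k : ℕ} (hk : k ≤ m) :
    f.coeff 0 * g.coeff (k + 1) < f.coeff (k + 1) * g.coeff 0 := by
  obtain ⟨hc, hst⟩ := (forall_re_neg_iff_routh_of_odd m hg hf).1 h
  set c := f.coeff 0 / g.coeff 0 with hcdef
  set g₁ := (f - C c * g).divX with hg₁
  have hg0' : g ≠ 0 := leadingCoeff_ne_zero.1 hlc.ne'
  have hp : (expand ℝ 2 f + Polynomial.X * expand ℝ 2 g).natDegree = 2 * m + 3 := by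
    rw [natDegree_even_add_odd_of_le_right hg0' (by omega), hg]; ring
  have hg0 : 0 < g.coeff 0 := by
    have := coeff_pos_of_forall_re_neg (by rwa [leadingCoeff_even_add_odd_of_odd hg0' (by omega)]) h 1 (by rw [hp]; omega)
    rwa [show (1 : ℕ) = 2 * 0 + 1 by ring, coeff_odd_eq] at this
  have hg₁d : g₁.natDegree ≤ m := by
    rw [hg₁, natDegree_divX_eq_natDegree_tsub_one]
    have : (f - C c * g).natDegree ≤ m + 1 := (natDegree_sub_le _ _).trans (max_le hf ((natDegree_C_mul_le _ _).trans hg.le))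
    omega
  have hp₁ : (expand ℝ 2 g + Polynomial.X * expand ℝ 2 g₁).natDegree = 2 * m + 2 := by
    rw [natDegree_even_add_odd_of_lt_left (by omega), hg]; ring
  have hlc₁ : 0 < (expand ℝ 2 g + Polynomial.X * expand ℝ 2 g₁).leadingCoeff := by
    rwa [leadingCoeff_even_add_odd_of_even (by omega)]
  have hpos := coeff_pos_of_forall_re_neg hlc₁ hst (2 * k + 1) (by rw [hp₁]; omega)
  rw [coeff_odd_eq, hg₁, coeff_divX_routh, hcdef, sub_pos, div_mul_eq_mul_div, div_lt_iff₀ hg0] at hpos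
  exact hpos

/-- **In the coefficients of `p` (even degree `2m + 4`): `p_0 · p_{2k+3} < p_{2k+2} · p_1` for `k ≤ m + 1`.** [this file §901] -/
theorem coeff_zero_mul_coeff_lt_of_even (m : ℕ) {f g : ℝ[X]} (hf : f.natDegree = m + 2) (hg : g.natDegree ≤ m + 1) (hlc : 0 < f.leadingCoeff)
    (h : ∀ z ∈ ((expand ℝ 2 f + Polynomial.X * expand ℝ 2 g).map (algebraMap ℝ ℂ)).roots, z.re < 0) {k : ℕ} (hk : k ≤ m + 1) :
    (expand ℝ 2 f + Polynomial.X * expand ℝ 2 g).coeff 0 * (expand ℝ 2 f + Polynomial.X * expand ℝ 2 g).coeff (2 * k + 3)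
      < (expand ℝ 2 f + Polynomial.X * expand ℝ 2 g).coeff (2 * k + 2) * (expand ℝ 2 f + Polynomial.X * expand ℝ 2 g).coeff 1 := by
  rw [show (0 : ℕ) = 2 * 0 by ring, coeff_even_eq, show 2 * k + 3 = 2 * (k + 1) + 1 by ring, coeff_odd_eq, show 2 * k + 2 = 2 * (k + 1) by ring, coeff_even_eq,
    show (1 : ℕ) = 2 * 0 + 1 by ring, coeff_odd_eq]
  exact coeff_mul_coeff_lt_of_forall_re_neg_of_even m hf hg hlc h hk

/-- **In the coefficients of `p` (odd degree `2m + 3`): `p_0 · p_{2k+3} < p_{2k+2} · p_1` for `k ≤ m`.** [this file §901] -/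
theorem coeff_zero_mul_coeff_lt_of_odd (m : ℕ) {f g : ℝ[X]} (hg : g.natDegree = m + 1) (hf : f.natDegree ≤ m + 1) (hlc : 0 < g.leadingCoeff)
    (h : ∀ z ∈ ((expand ℝ 2 f + Polynomial.X * expand ℝ 2 g).map (algebraMap ℝ ℂ)).roots, z.re < 0) {k : ℕ} (hk : k ≤ m) :
    (expand ℝ 2 f + Polynomial.X * expand ℝ 2 g).coeff 0 * (expand ℝ 2 f + Polynomial.X * expand ℝ 2 g).coeff (2 * k + 3)
      < (expand ℝ 2 f + Polynomial.X * expand ℝ 2 g).coeff (2 * k + 2) * (expand ℝ 2 f + Polynomial.X * expand ℝ 2 g).coeff 1 := by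
  rw [show (0 : ℕ) = 2 * 0 by ring, coeff_even_eq, show 2 * k + 3 = 2 * (k + 1) + 1 by ring, coeff_odd_eq, show 2 * k + 2 = 2 * (k + 1) by ring, coeff_even_eq,
    show (1 : ℕ) = 2 * 0 + 1 by ring, coeff_odd_eq]
  exact coeff_mul_coeff_lt_of_forall_re_neg_of_odd m hg hf hlc h hk

end Summit.Ventures.HSemireg.Wedge.HankelOuter
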